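import Summits.NavierStokesRegularity.NavierStokesRegularity.Theorems.TerminalTraceTypeITraceScarL3ExtinctApexPairingModulus
import Literature.Analysis.FluidPDE.SereginSverak2002FinalEnergy
import HarnessLib

/-!
# Line `extinct-apex` of `TerminalTrace.TypeITraceScarL3`, Stub 2 — tool file 3/3: an `L³` ball of
# the final value has no scaled-energy concentration, and the vertex blow-up limit then vanishes
# weakly at the top time (Type-I data)

Route `TerminalTrace` (NavierStokesRegularity), item `TypeITraceScarL3` (stmt-NavierStokesRegularity-18385),
registered skeleton `extinct-apex` (nsreg-p2 g26, sha16 07e82d2c7e70161a), Stub 2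
`stub_extinctApex_of_L3trace` (a Type-I-in-time blow-up with an `L³` terminal ball at a
backward-singular apex zooms to an EXTINCT Type-I apex).  Seat ns-typeII-p3 g9 (cell
ns-regularity-ideate), helper file `--supports stmt-NavierStokesRegularity-18385`.

The tree proves the weak vanishing of a vertex blow-up limit at its final time in
Seregin–Šverák's ONE-SIDED-PRESSURE setting (`SereginSverak2002.zoom_slice_pairing_bound`,
`….zoom_pairing_modulus`, `….ae_abs_pairing_le_near_top_of_scaledEnergy`); there the pressure sign
serves only to produce (i) a Morrey bound `∫_{B(x₀,ρ)} |u(t)|² ≤ M ρ` near the vertex and (ii) a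
scale-invariant `L^{3/2}` bound on the pressure in the vertex cylinders.  The three files
`…ExtinctApexSliceBound`, `…ExtinctApexPairingModulus`, `…ExtinctApexTopVanishing` re-run those
proofs with (i) and (ii) as HYPOTHESES — (ii) in the mean-free form
`cknDOsc ρ (T, x₀) p ≤ I₀` (the `D` of Albritton–Barker's `𝐈`, exactly what a local Type-I bound
at the apex supplies; `∫ p div φ` does not see the ball mean) — which is the form a Type-I blow-up
delivers (`morrey_of_typeI`, `exists_zoom_typeIBound_lt_top_of_morrey`).

This file (3/3), unit viscosity, `(u, p)` classical on `[0, T) × ℝ³` and Leray–Hopf on `[0, T]`: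

* `tendsto_scaledEnergy_zero_of_memLp_three` — `b ∈ L³(B(x₀, ρ))` ⇒ `r⁻¹ ∫_{B(x₀,r)} |b|² → 0`
  as `r → 0⁺` (Hölder `L² ≤ L³ |B_r|^{1/6}` and absolute continuity of `|b|³`) — the `L³`-trace
  hypothesis of Stub 2 in the scaled-energy currency of `SereginSverak2002.*`;
* `ae_abs_pairing_le_near_top_of_morrey` — under the Morrey and mean-free pressure bounds at the
  vertex `(T, x₀)` and `r⁻¹ ∫_{B(x₀,r)} |u(T)|² → 0`, the `L³(Q(a))`-limit `w` of the zooms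
  `u_{R_j}`, `R_j → 0⁺`, satisfies: for every `φ ∈ C_c^∞(B(0,a))` and `η > 0` there is `δ > 0`
  with `|∫ ⟪w(s), φ⟫| ≤ η` for a.e. `s ∈ (−δ, 0)` (the modulus of file 2/3 is uniform in the
  scale; the zooms of the final value pair to `0` by `tendsto_integral_inner_zoom_of_scaledEnergy`;
  slices of the zooms converge a.e. along a subsequence, `exists_subseq_ae_tendsto_pairing`).

WHAT THIS IS NOT: not NS regularity, not item 18385, not Stub 3 — bookkeeping of
Seregin–Šverák 2002 §4 under Type-I data.  [folklore; cf. SereginSverak2002 §4 (4.8)]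
-/

noncomputable section

set_option linter.dupNamespace false

open MeasureTheory TopologicalSpace Set Function Filter Topology Metric InnerProductSpace Real
open scoped ENNReal NNReal RealInnerProductSpace ContDiff Laplacian

namespace Summit.NavierStokesRegularity.NavierStokesRegularity.Theorems.TypeITraceScarL3

open Literature.Analysis Literature.Analysis.FluidPDE Literature.Analysis.FluidPDE.SereginSverak2002

variable {T : ℝ} {u : ℝ → EuclideanSpace ℝ (Fin 3) → EuclideanSpace ℝ (Fin 3)}
  {p : ℝ → EuclideanSpace ℝ (Fin 3) → ℝ}

/-! ### An `L³` ball of the final value forbids scaled-energy concentration -/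

/-- **A field which is `L³` on a ball around `x₀` has no scaled-energy concentration at `x₀`:**
`r⁻¹ ∫_{B(x₀, r)} ‖b‖² → 0` as `r → 0⁺`.  Hölder on `B(x₀, r)`:
`∫_{B_r} ‖b‖² ≤ ‖b‖²_{L³(B_r)} |B_r|^{1/3}` with `|B_r|^{1/3} = |B_1|^{1/3} r`, and
`‖b‖_{L³(B_r)} → 0` by the absolute continuity of the integral. [folklore] -/
theorem tendsto_scaledEnergy_zero_of_memLp_three {b : EuclideanSpace ℝ (Fin 3) → EuclideanSpace ℝ (Fin 3)}
    {x₀ : EuclideanSpace ℝ (Fin 3)} {ρ : ℝ} (hρ : 0 < ρ)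
    (hb : MemLp b 3 (volume.restrict (ball x₀ ρ))) :
    Tendsto (fun r : ℝ => r⁻¹ * ∫ x in ball x₀ r, ‖b x‖ ^ 2) (𝓝[>] 0) (𝓝 0) := by
  set μ : Measure (EuclideanSpace ℝ (Fin 3)) := volume.restrict (ball x₀ ρ) with hμ
  set V₁ : ℝ := volume.real (ball (0 : EuclideanSpace ℝ (Fin 3)) 1) with hV₁
  have hV₁0 : 0 ≤ V₁ := measureReal_nonneg
  -- the `L³` norm on small balls, as a real number
  set N : ℝ → ℝ := fun r => (eLpNorm ((ball x₀ r).indicator b) 3 μ).toReal with hN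
  have hN0 : ∀ r, 0 ≤ N r := fun r => ENNReal.toReal_nonneg
  -- ## Step 1: `N r → 0` as `r → 0⁺` (absolute continuity of `‖b‖³`)
  have hNt : Tendsto N (𝓝[>] 0) (𝓝 0) := by
    rw [Metric.tendsto_nhdsWithin_nhds]
    intro ε hε
    obtain ⟨δ, hδ, hδε⟩ := hb.eLpNorm_indicator_le (by norm_num) (by norm_num) (half_pos hε)
    -- `volume (ball x₀ r) = V r³ ≤ δ` for small `r`
    have hvol : Tendsto (fun r : ℝ => (volume (ball x₀ r)).toReal) (𝓝[>] 0) (𝓝 0) := by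
      have e : ∀ r : ℝ, 0 < r → (volume (ball x₀ r)).toReal = V₁ * r ^ 3 := by
        intro r hr
        rw [Measure.addHaar_ball volume x₀ hr.le, finrank_euclideanSpace_fin, ENNReal.toReal_mul,
          ENNReal.toReal_ofReal (by positivity), hV₁, Measure.real, mul_comm]
      have h0 : Tendsto (fun r : ℝ => V₁ * r ^ 3) (𝓝[>] 0) (𝓝 0) := by
        have : Tendsto (fun r : ℝ => V₁ * r ^ 3) (𝓝 0) (𝓝 (V₁ * 0 ^ 3)) :=
          ((continuous_const.mul (continuous_pow 3)).tendsto 0)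
        rw [zero_pow three_ne_zero, mul_zero] at this
        exact this.mono_left nhdsWithin_le_nhds
      refine h0.congr' ?_
      filter_upwards [self_mem_nhdsWithin] with r hr using (e r hr).symm
    have hevδ : ∀ᶠ r in 𝓝[>] (0 : ℝ), (volume (ball x₀ r)).toReal < δ :=
      hvol (Iio_mem_nhds hδ)
    obtain ⟨d, hd, hdδ⟩ := (mem_nhdsGT_iff_exists_Ioo_subset).1 hevδ
    refine ⟨d, hd, fun r hr hrd => ?_⟩
    have hr0 : 0 < r := hr
    rw [dist_zero_right, Real.norm_of_nonneg hr0.le] at hrd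
    have hrδ : (volume (ball x₀ r)).toReal < δ := hdδ ⟨hr0, hrd⟩
    have hμr : μ (ball x₀ r) ≤ ENNReal.ofReal δ := by
      have h1 : μ (ball x₀ r) ≤ volume (ball x₀ r) := Measure.restrict_apply_le _ _
      refine h1.trans ?_
      rw [← ENNReal.ofReal_toReal measure_ball_lt_top.ne]
      exact ENNReal.ofReal_le_ofReal hrδ.le
    have hle := hδε (ball x₀ r) measurableSet_ball hμr
    rw [dist_zero_right, Real.norm_of_nonneg (hN0 r), hN]
    calc (eLpNorm ((ball x₀ r).indicator b) 3 μ).toReal ≤ (ENNReal.ofReal (ε / 2)).toReal :=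
          ENNReal.toReal_mono ENNReal.ofReal_ne_top hle
      _ = ε / 2 := ENNReal.toReal_ofReal (half_pos hε).le
      _ < ε := half_lt_self hε
  -- ## Step 2: the Hölder bound `r⁻¹ ∫_{B_r} ‖b‖² ≤ V₁^{1/3} (N r)²` for `0 < r ≤ ρ`
  have hbound : ∀ r : ℝ, 0 < r → r ≤ ρ →
      r⁻¹ * ∫ x in ball x₀ r, ‖b x‖ ^ 2 ≤ V₁ ^ (1 / 3 : ℝ) * (N r) ^ 2 := by
    intro r hr hrρ
    have hsub : ball x₀ r ⊆ ball x₀ ρ := ball_subset_ball hrρ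
    set μr : Measure (EuclideanSpace ℝ (Fin 3)) := volume.restrict (ball x₀ r) with hμr
    have hμr_eq : μr = μ.restrict (ball x₀ r) := by
      rw [hμr, hμ, Measure.restrict_restrict measurableSet_ball, inter_eq_self_of_subset_left hsub]
    haveI : IsFiniteMeasure μr := ⟨by rw [hμr, Measure.restrict_apply_univ]; exact measure_ball_lt_top⟩
    have hbr : MemLp b 3 μr := by
      rw [hμr_eq]; exact hb.restrict _
    have hmeas : AEStronglyMeasurable b μr := hbr.aestronglyMeasurable
    -- `‖b‖_{L²(B_r)} ≤ ‖b‖_{L³(B_r)} |B_r|^{1/6}`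
    have hH := eLpNorm_le_eLpNorm_mul_rpow_measure_univ (p := 2) (q := 3) (by norm_num) hmeas (μ := μr)
    have hexp : (1 / (2 : ℝ≥0∞).toReal - 1 / (3 : ℝ≥0∞).toReal : ℝ) = 1 / 6 := by norm_num
    rw [hexp] at hH
    -- the `L³` norm on `B_r` is `N r`
    have hN3 : eLpNorm b 3 μr = eLpNorm ((ball x₀ r).indicator b) 3 μ := by
      rw [hμr_eq, eLpNorm_indicator_eq_eLpNorm_restrict measurableSet_ball]
    have hNr : eLpNorm b 3 μr = ENNReal.ofReal (N r) := by
      rw [hN3, hN, ENNReal.ofReal_toReal]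
      rw [← hN3]; exact hbr.eLpNorm_ne_top
    -- the `L²` norm squared is the integral
    have hb2 : MemLp b 2 μr := hbr.mono_exponent (by norm_num)
    have hint : ∫ x in ball x₀ r, ‖b x‖ ^ 2 = ((eLpNorm b 2 μr) ^ 2).toReal := by
      have h1 := MemLp.eLpNorm_eq_integral_rpow_norm (by norm_num) (by norm_num) hb2
      rw [h1]
      simp only [ENNReal.toReal_ofNat]
      have hI0 : 0 ≤ ∫ x, ‖b x‖ ^ (2 : ℝ) ∂μr := integral_nonneg fun x => by positivity
      rw [← ENNReal.ofReal_pow (by positivity), ENNReal.toReal_ofReal (by positivity), ← Real.rpow_natCast,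
        ← Real.rpow_mul hI0]
      norm_num
      all_goals simp only [hμr]
    -- the measure of the ball
    have hvolr : μr univ = ENNReal.ofReal (V₁ * r ^ 3) := by
      rw [hμr, Measure.restrict_apply_univ, Measure.addHaar_ball volume x₀ hr.le,
        finrank_euclideanSpace_fin, hV₁, Measure.real, ENNReal.ofReal_mul' (by positivity),
        ENNReal.ofReal_toReal measure_ball_lt_top.ne, mul_comm]
    have hvol6 : (μr univ) ^ (1 / 6 : ℝ) = ENNReal.ofReal ((V₁ * r ^ 3) ^ (1 / 6 : ℝ)) := by
      rw [hvolr, ENNReal.ofReal_rpow_of_nonneg (by positivity) (by norm_num)]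
    rw [hNr, hvol6, ← ENNReal.ofReal_mul (hN0 r)] at hH
    -- pass to reals
    have h2 : (eLpNorm b 2 μr).toReal ≤ N r * (V₁ * r ^ 3) ^ (1 / 6 : ℝ) :=
      ENNReal.toReal_le_of_le_ofReal (by positivity) hH
    have h2sq : ((eLpNorm b 2 μr) ^ 2).toReal ≤ (N r * (V₁ * r ^ 3) ^ (1 / 6 : ℝ)) ^ 2 := by
      rw [ENNReal.toReal_pow]
      exact pow_le_pow_left₀ ENNReal.toReal_nonneg h2 2
    have hr3 : ((V₁ * r ^ 3) ^ (1 / 6 : ℝ)) ^ 2 = V₁ ^ (1 / 3 : ℝ) * r := by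
      rw [← Real.rpow_natCast, ← Real.rpow_mul (by positivity), Real.mul_rpow hV₁0 (by positivity)]
      norm_num
      rw [show (r ^ 3 : ℝ) = r ^ (3 : ℝ) by norm_cast, ← Real.rpow_mul hr.le]
      norm_num
    rw [hint]
    calc r⁻¹ * ((eLpNorm b 2 μr) ^ 2).toReal ≤ r⁻¹ * (N r * (V₁ * r ^ 3) ^ (1 / 6 : ℝ)) ^ 2 :=
          mul_le_mul_of_nonneg_left h2sq (inv_nonneg.2 hr.le)
      _ = V₁ ^ (1 / 3 : ℝ) * (N r) ^ 2 := by
          rw [mul_pow, hr3]; field_simp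
  -- ## Step 3: squeeze
  have hupper : Tendsto (fun r => V₁ ^ (1 / 3 : ℝ) * (N r) ^ 2) (𝓝[>] 0) (𝓝 0) := by
    have := (hNt.pow 2).const_mul (V₁ ^ (1 / 3 : ℝ))
    rwa [zero_pow two_ne_zero, mul_zero] at this
  have hlower : ∀ r : ℝ, 0 < r → 0 ≤ r⁻¹ * ∫ x in ball x₀ r, ‖b x‖ ^ 2 := fun r hr =>
    mul_nonneg (inv_nonneg.2 hr.le) (integral_nonneg fun x => sq_nonneg _)
  refine tendsto_of_tendsto_of_tendsto_of_le_of_le' tendsto_const_nhds hupper ?_ ?_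
  · filter_upwards [self_mem_nhdsWithin] with r hr using hlower r hr
  · filter_upwards [Ioo_mem_nhdsGT hρ] with r hr using hbound r hr.1 hr.2.le

/-! ### The blow-up limit vanishes weakly at the final time -/

set_option maxHeartbeats 800000 in
/-- **The vertex blow-up limit vanishes weakly at the final time, Type-I form.**  Setting of
`zoom_pairing_modulus_of_morrey` (classical on `[0, T)`, Leray–Hopf on `[0, T]`, `ν = 1`, Morrey
bound and mean-free pressure bound at the vertex `(T, x₀)`), and suppose the final value has no
scaled-energy concentration at `x₀` (`r⁻¹ ∫_{B(x₀,r)} |u(T)|² → 0`).  Let `w` be the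
`L³(Q(a))`-limit of the zooms `u_{R_j}`, `R_j → 0⁺`.  Then for every test field
`φ ∈ C_c^∞(B(0, a))` and `η > 0` there is `δ > 0` with `|∫ ⟪w(s), φ⟫| ≤ η` for a.e. `s ∈ (−δ, 0)`.
The proof is that of `SereginSverak2002.ae_abs_pairing_le_near_top_of_scaledEnergy` with the
modulus of `zoom_pairing_modulus_of_morrey`. [folklore; cf. SereginSverak2002 §4 (4.8)] -/
theorem ae_abs_pairing_le_near_top_of_morrey (hT : 0 < T)
    (hsol : IsClassicalNSSolutionOn (Ico 0 T) 1 0 u p) (hLH : IsLerayHopfOn T 1 0 (u 0) u)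
    (x₀ : EuclideanSpace ℝ (Fin 3)) {r₀ M₀ T₁ : ℝ} (hr₀ : 0 < r₀) (hT₁ : T₁ < T)
    (hMor : ∀ t ∈ Ioo T₁ T, ∀ ρ : ℝ, 0 < ρ → ρ ≤ r₀ → ∫ x in ball x₀ ρ, ‖u t x‖ ^ 2 ≤ M₀ * ρ)
    {ρ₀ : ℝ} {I₀ : ℝ≥0} (hρ₀ : 0 < ρ₀)
    (hD : ∀ ρ : ℝ, 0 < ρ → ρ ≤ ρ₀ → cknDOsc ρ ((T : ℝ), x₀) p ≤ I₀)
    (hFE : Tendsto (fun r : ℝ => r⁻¹ * ∫ x in ball x₀ r, ‖u T x‖ ^ 2) (𝓝[>] 0) (𝓝 0))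
    {R : ℕ → ℝ} (hRpos : ∀ j, 0 < R j) (hR0 : Tendsto R atTop (𝓝 0))
    {w : ℝ → EuclideanSpace ℝ (Fin 3) → EuclideanSpace ℝ (Fin 3)} {a : ℝ} (ha : 1 ≤ a)
    (hw3 : MemLp (uncurry w) 3
      (volume.restrict (parabolicCylinder a (0 : ℝ × EuclideanSpace ℝ (Fin 3)))))
    (hconv : Tendsto (fun j => eLpNorm
        (uncurry ((R j) • stPull ((R j) ^ 2) (R j) T x₀ u) - uncurry w) 3
        (volume.restrict (parabolicCylinder a (0 : ℝ × EuclideanSpace ℝ (Fin 3)))))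
      atTop (𝓝 0))
    {φ : EuclideanSpace ℝ (Fin 3) → EuclideanSpace ℝ (Fin 3)} (hφ : ContDiff ℝ ∞ φ)
    (hφc : HasCompactSupport φ) (hφa : tsupport φ ⊆ ball (0 : EuclideanSpace ℝ (Fin 3)) a)
    {η : ℝ} (hη : 0 < η) :
    ∃ δ > 0, ∀ᵐ s ∂(volume : Measure ℝ), s ∈ Ioo (-δ) 0 → |∫ y, ⟪w s y, φ y⟫| ≤ η := by
  -- adapted from Literature/Analysis/FluidPDE/SereginSverak2002FinalEnergy.lean
  -- (`SereginSverak2002.ae_abs_pairing_le_near_top_of_scaledEnergy`)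
  have ha0 : 0 < a := by linarith
  obtain ⟨C, hC0, R₀, hR₀, hmod⟩ :=
    zoom_pairing_modulus_of_morrey hT hsol hLH x₀ hr₀ hT₁ hMor hρ₀ hD hφ hφc ha hφa
  obtain ⟨δ, hδ, hδ1, hδC⟩ := exists_delta_modulus_le hC0 hη
  refine ⟨δ, hδ, ?_⟩
  have hφs : ∀ y, y ∉ ball (0 : EuclideanSpace ℝ (Fin 3)) a → φ y = 0 := fun y hy =>
    image_eq_zero_of_notMem_tsupport fun h => hy (hφa h)
  obtain ⟨M, hM⟩ := hφ.continuous.bounded_above_of_compact_support hφc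
  obtain ⟨κ, hκ, hae⟩ := exists_subseq_ae_tendsto_pairing hT hsol x₀ hRpos hR0 hw3 hconv hφ.continuous hM hφs
  have hTI : T ∈ Icc 0 T := ⟨hT.le, le_rfl⟩
  have hb2 : MemLp (u T) 2 volume := hLH.memLp T hTI
  have hZ : Tendsto (fun k => ∫ y, ⟪R (κ k) • u T (x₀ + R (κ k) • y), φ y⟫) atTop (𝓝 0) :=
    tendsto_integral_inner_zoom_of_scaledEnergy hb2 x₀ hFE hφ.continuous hM ha0 hφs (fun k => hRpos _)
      (hR0.comp hκ.tendsto_atTop)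
  have hevR : ∀ᶠ k in atTop, R (κ k) ≤ R₀ :=
    (hR0.comp hκ.tendsto_atTop).eventually (Iic_mem_nhds hR₀)
  have hae' := (ae_restrict_iff' measurableSet_Ioo).1 hae
  filter_upwards [hae'] with s hs hsδ
  have hsa : s ∈ Ioo (-a ^ 2) 0 := ⟨by nlinarith [hsδ.1, hδ1, ha], hsδ.2⟩
  have hs1 : s ∈ Ioo (-1 : ℝ) 0 := ⟨by linarith [hsδ.1], hsδ.2⟩
  have hsabs : |s| < δ := by rw [abs_of_neg hsδ.2]; linarith [hsδ.1]
  have hlimP := (hs hsa).abs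
  have hev : ∀ᶠ k in atTop, |∫ y, ⟪R (κ k) • u (T + R (κ k) ^ 2 * s) (x₀ + R (κ k) • y), φ y⟫| ≤
      |∫ y, ⟪R (κ k) • u T (x₀ + R (κ k) • y), φ y⟫| + C * (|s| + |s| ^ (1 / 3 : ℝ)) := by
    filter_upwards [hevR] with k hk
    have h := hmod (R (κ k)) (hRpos _) hk s hs1
    have := abs_sub_abs_le_abs_sub (∫ y, ⟪R (κ k) • u (T + R (κ k) ^ 2 * s) (x₀ + R (κ k) • y), φ y⟫)
      (∫ y, ⟪R (κ k) • u T (x₀ + R (κ k) • y), φ y⟫)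
    linarith
  have hlimZ : Tendsto (fun k => |∫ y, ⟪R (κ k) • u T (x₀ + R (κ k) • y), φ y⟫| + C * (|s| + |s| ^ (1 / 3 : ℝ)))
      atTop (𝓝 (0 + C * (|s| + |s| ^ (1 / 3 : ℝ)))) := by
    have := hZ.abs
    rw [abs_zero] at this
    exact this.add_const _
  have hle := le_of_tendsto_of_tendsto hlimP hlimZ hev
  rw [zero_add] at hle
  exact hle.trans (hδC s hsabs)


end Summit.NavierStokesRegularity.NavierStokesRegularity.Theorems.TypeITraceScarL3

end
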